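import Summits.CriticalPhenomena.PercolationContinuityZ3.Theorems.PercNearOneGluingNoHeavyQuantFarShieldedRelay
import HarnessLib

/-!
# QUANT lane R8, front "FAR beyond trees", layer one — THE MOAT LEMMA (relays guarding a region certify the layer-one FAR conclusion)

builds on p205010 (kernel theorem, internal audit signed; external expert review pending)

Support file (`--supports stmt-CriticalPhenomena-4575`), seat `prim-quant-p1` (gen 25); memo
`run/shared/lean/prim/quant/prim-quant-p1-g25/FOR-LEAD-TWOTERMINAL.md` §3, §10(f).  Standard axioms; no sorries; no definitions.  Pure graph-level argument
(no block machinery): the common generalisation of the shielded-relay lemma (`…QuantFarShieldedRelay`: `Z` = closed neighbourhood of `a`) and of the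
guarded two-terminal block (`…QuantFarGuardedBlock`: `Z` = a block hanging at two terminals whose entrances are relays).

MOAT: a vertex set `Z` not containing the observer, a relay `a ∈ A ∩ Z`, and the condition that every vertex of `Z` joined by a pair of positive weight to a
vertex outside `Z` (an ENTRANCE of `Z`) is a relay other than `a`.  Then almost surely every open path from `o` to `a` enters `Z` at an entrance, which is a
second reached relay: `{o ↔ a} ⊆ {N ≥ 2}` a.s., hence
* **`Quant.real_card_le_one_le_of_moat`**: `P(#{x ∈ A : o ↔ x} ≤ 1) ≤ P(o ↮ a)` on EVERY finite weighted graph — no mean hypothesis, nothing assumed outside `Z`;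
* `Quant.farLayerOne_of_moat`: the `j = 1` conclusion of `Quant.FarRelayRow` (`P(o ↮ x) ≤ t` on `A` ⟹ `P(N ≤ 1) ≤ t`).
Structure of a minimal counterexample to FAR at layer one (cumulative): no relay sits behind a moat of relays — in particular no ear whose two end vertices are
sure relays carries a third relay, and no relay has all its neighbours in `A`.
[cite: Grimmett1999, §1.3 p. 10] (open paths; weight-zero pairs are a.s. closed); the lemma is [this work].
-/

noncomputable section

namespace Summit.CriticalPhenomena.PercolationContinuityZ3.Theorems

namespace Quant

open Finset MeasureTheory Set
open Literature.Probability.LatticeModels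
open Literature.Probability.Percolation
open scoped Classical

variable {n : ℕ}

/-- **Entering a region.**  An open walk from a vertex outside `Z` to a vertex inside `Z` crosses an open pair `s(y, z)` with `y ∉ Z`, `z ∈ Z`, and its
start is joined to `z`. [this work] -/
theorem exists_entrance_of_walk {ω : BondConfig (Fin n)} {Z : Finset (Fin n)} {a : Fin n} (ha : a ∈ Z) :
    ∀ (v : Fin n) (_ : (openGraph ω).Walk v a), v ∉ Z →
      ∃ y z : Fin n, y ∉ Z ∧ z ∈ Z ∧ s(y, z) ∈ ω ∧ y ≠ z ∧ (openGraph ω).Reachable v z := by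
  intro v q
  induction q with
  | nil => exact fun hv => absurd ha hv
  | cons hadj q' ih =>
    rename_i v' x a'
    intro hv
    have hadj' := hadj
    rw [openGraph_adj] at hadj
    obtain ⟨he, hne⟩ := hadj
    by_cases hx : x ∈ Z
    · exact ⟨v', x, hv, hx, he, hne, hadj'.reachable⟩
    · obtain ⟨y, z, hy, hz, hyz, hne', hxz⟩ := ih ha hx
      exact ⟨y, z, hy, hz, hyz, hne', hadj'.reachable.trans hxz⟩

/-- **Combinatorial core of the moat lemma**: if every open pair from outside `Z` into `Z` ends at a relay other than `a`, then `o ↔ a` (`o ∉ Z`, `a ∈ A ∩ Z`)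
forces at least two relays joined to `o`. [this work] -/
theorem two_le_card_of_moat {ω : BondConfig (Fin n)} {Z A : Finset (Fin n)} {o a : Fin n} (ho : o ∉ Z) (haA : a ∈ A) (haZ : a ∈ Z)
    (hmoat : ∀ y z : Fin n, y ∉ Z → z ∈ Z → s(y, z) ∈ ω → z ∈ A ∧ z ≠ a) (h : (openGraph ω).Reachable o a) :
    2 ≤ (A.filter fun x => ω ∈ openConn o x).card := by
  obtain ⟨p⟩ := h
  obtain ⟨y, z, hy, hz, hyz, -, hoz⟩ := exists_entrance_of_walk haZ o p ho
  obtain ⟨hzA, hza⟩ := hmoat y z hy hz hyz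
  have hsub : ({z, a} : Finset (Fin n)) ⊆ A.filter fun x => ω ∈ openConn o x := by
    intro x hx
    rw [mem_filter]
    rcases mem_insert.1 hx with rfl | hx
    · exact ⟨hzA, hoz⟩
    · rw [mem_singleton.1 hx]; exact ⟨haA, ⟨p⟩⟩
  calc 2 = ({z, a} : Finset (Fin n)).card := by rw [card_pair hza]
    _ ≤ _ := card_le_card hsub

/-- **The moat lemma.**  For every finite weighted graph `w` on `Fin n`, relay set `A`, observer `o`, vertex set `Z ∌ o` and relay `a ∈ A ∩ Z` such that every
entrance of `Z` is a relay other than `a` (`y ∉ Z`, `z ∈ Z`, `w(s(y,z)) ≠ 0 ⟹ z ∈ A ∧ z ≠ a`): `P(#{x ∈ A : o ↔ x} ≤ 1) ≤ P(o ↮ a)`. [this work] -/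
theorem real_card_le_one_le_of_moat (w : Sym2 (Fin n) → unitInterval) (A Z : Finset (Fin n)) {o a : Fin n} (ho : o ∉ Z) (haA : a ∈ A) (haZ : a ∈ Z)
    (hmoat : ∀ y z : Fin n, y ∉ Z → z ∈ Z → (w s(y, z) : ℝ) ≠ 0 → z ∈ A ∧ z ≠ a) :
    (prodBernoulli w).real {ω : BondConfig (Fin n) | (A.filter fun x => ω ∈ openConn o x).card ≤ 1} ≤
      (prodBernoulli w).real (openConn o a : Set (BondConfig (Fin n)))ᶜ := by
  set μ := prodBernoulli w with hμ
  have hmeas : ∀ U : Set (BondConfig (Fin n)), MeasurableSet U := fun U => (Set.toFinite U).measurableSet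
  -- pairs from outside `Z` into `Z` that do not end at a relay `≠ a` have weight zero, hence are a.s. closed
  set Bd : Finset (Sym2 (Fin n)) := Finset.univ.filter fun e => ∃ y z : Fin n, y ∉ Z ∧ z ∈ Z ∧ e = s(y, z) ∧ ¬ (z ∈ A ∧ z ≠ a) with hBd
  set Nbad : Set (BondConfig (Fin n)) := {ω | ∃ e ∈ Bd, e ∈ ω} with hN
  have hN0 : μ.real Nbad = 0 := by
    have h0 : μ Nbad = 0 := by
      apply prodBernoulli_setOf_exists_mem_eq_zero
      intro e he
      obtain ⟨y, z, hy, hz, rfl, hza⟩ := (Finset.mem_filter.1 he).2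
      by_contra hne
      exact hza (hmoat y z hy hz hne)
    simp [measureReal_def, h0]
  set S := {ω : BondConfig (Fin n) | (A.filter fun x => ω ∈ openConn o x).card ≤ 1} with hS
  have hsub : S \ Nbad ⊆ (openConn o a : Set (BondConfig (Fin n)))ᶜ := by
    rintro ω ⟨hωS, hωN⟩ hωa
    have hmoat' : ∀ y z : Fin n, y ∉ Z → z ∈ Z → s(y, z) ∈ ω → z ∈ A ∧ z ≠ a := by
      intro y z hy hz he
      by_contra hza
      exact hωN ⟨s(y, z), Finset.mem_filter.2 ⟨Finset.mem_univ _, y, z, hy, hz, rfl, hza⟩, he⟩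
    have h2 := two_le_card_of_moat ho haA haZ hmoat' hωa
    simp only [hS, mem_setOf_eq] at hωS
    omega
  have hsplit : μ.real S = μ.real (S \ Nbad) := by
    have h := measureReal_inter_add_sdiff (μ := μ) (s := S) (hmeas Nbad)
    have h0 : μ.real (S ∩ Nbad) = 0 :=
      le_antisymm ((measureReal_mono Set.inter_subset_right).trans hN0.le) measureReal_nonneg
    linarith
  rw [hsplit]
  exact measureReal_mono hsub (measure_ne_top _ _)

/-- **FAR at layer one behind a moat** (route vocabulary): under the hypotheses of `real_card_le_one_le_of_moat`, `P(o ↮ x) ≤ t` for all `x ∈ A` implies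
`P(#{x ∈ A : o ↔ x} ≤ 1) ≤ t` (no mean hypothesis needed). [this work] -/
theorem farLayerOne_of_moat (w : Sym2 (Fin n) → unitInterval) (A Z : Finset (Fin n)) {o a : Fin n} (ho : o ∉ Z) (haA : a ∈ A) (haZ : a ∈ Z)
    (hmoat : ∀ y z : Fin n, y ∉ Z → z ∈ Z → (w s(y, z) : ℝ) ≠ 0 → z ∈ A ∧ z ≠ a) (t : ℝ)
    (hcut : ∀ x ∈ A, (prodBernoulli w).real (openConn o x : Set (BondConfig (Fin n)))ᶜ ≤ t) :
    (prodBernoulli w).real {ω : BondConfig (Fin n) | (A.filter fun x => ω ∈ openConn o x).card ≤ 1} ≤ t :=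
  (real_card_le_one_le_of_moat w A Z ho haA haZ hmoat).trans (hcut a haA)

end Quant

end Summit.CriticalPhenomena.PercolationContinuityZ3.Theorems
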